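/- Copyright: the b2b-balaban cell (near-miss cell 7), T⁴-continuum fan-out; row NE7b CRUX team (2), seat
t4-ne7b-formalise-leaf-03 (gen 28) — custodian's D-50-2′ «THE WEIGHTED PLUG CHAIN», part 5 = THE D-50-2 DELIVERABLE
(R-OWNER-51-1 (5), W-ne7bp1-g51-2∕-5, INTERFACE REQUEST NE7b IR-51-2), file 1 of 2: the prefix record `HistReadDataLW`
embedded into the plug record at M5-2e's weight `cvol82` and window `ellVolS82` (leaf-06's IR-51-1
`HistoryBankingVolumeWindowShrunk82`, the OWNER's (E5) `HistoryBankingShrunkWitness82`), the window-EXPLICIT L-witness at `ellVolS82`, and a SECOND PROOF of its (window-blind) terminal theorem of record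
through that ledger; file 2 (`…AssemblyWTVSLWKP82`) does the decorated ∕ key-side records.  Released under the licence of
the surrounding project. -/
import Summits.QuantumFields.BalabanUV.T4Continuum.Support.HistoryRealiseCellsRunAssemblyWTVSLP
import Summits.QuantumFields.BalabanUV.T4Continuum.Support.HistoryRealiseCellsRunAssemblyWTVSLW
import Summits.QuantumFields.BalabanUV.T4Continuum.Support.HistoryBankingVolumeWindowShrunk82
import Summits.QuantumFields.BalabanUV.T4Continuum.Support.HistoryBankingShrunkWitness82

/-!
# D-50-2 «THE SHRUNK RECORD» DELIVERED AS AN EMBEDDING, file 1: `HistReadDataLW.toLP82`, THE WINDOW-EXPLICIT L-WITNESS OF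
# THE PREFIX RECORD ON M5-2e's LEDGER (window `ellVolS82`, weight `cvol82`), AND A SECOND PROOF OF ITS TERMINAL THEOREM
# (D-50-2′ part 5, IR-51-2; re-open object (α) of row NE7b; custodian lineage `t4-ne7b-formalise-leaf-03` gen 28)

Summits-side support leaf of the T⁴-continuum cell (rung (B)+1 on a FINITE torus only; NOT infinite volume, NOT the
mass gap, NOT the Clay statement; NOT a proof of the spine estimate NE7b — the cell's OWN estimate, NOT PRINTED, NOT
PROVED).  [folklore] composition BY NAME: one `def` (the embedding `HistReadDataLW.toLP82`, data-level — part 2's `toL`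
with the ten M5-2c volume fields replaced by the weight `cvol82 d (jvol82 d (1+β₀)) (1+β₀)`, its floor `two_pow_le_cvol82`,
THE PLUG discharged per term by (E5) `exp_volume_le_genT_shrunk82` from leaf-06's `volumeDisplaysS82_of_log_eq_of_inInterval`
at the record's `hΛ`, and `huV` by `huθS82_births_of_log_eq_of_inInterval`), three theorems and one `example`; no `[cite:]`
tag, nothing printed asserted, no `Prop` fact minted, zero `sorry`.  NO record is twinned: `HistReadDataLW` (and, in file 2, `…LWD`∕`…LWK`)
are consumed AS THEY ARE — their run-B display `upB` at `2^{d+3}` serves `cvol82 ≥ 2^{d+3}` through part 4 §1's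
`LIVEOf_mono_const`.

WHY (R-OWNER-51-1 (3)∕(5); refuter F96∕F99, balaban-calc G39 → VOLUME-4).  The terminal theorems of record
(`continuumYM4Torus_of_histReadingLW_fsc` p290621, `…LWD_fsc` p295979, `…LWK_fsc` p298331) run on M5-2c's lag ledger at the
window `ellVol` (census: lattice prefix threshold `9.51·10¹⁰·ρ`, then M5-2d's `5.67·10⁵·ρ` — vacuous at ratio one); M5-2e's
per-level dead box lowers the floor exchange to `6·collar82 d` (`361.46·ρ` at `d = 4` under reading (A): NIL iff
`ρ ≤ 1.2067 … 1.5632` — thin but true at ratio one, refuter v20 F109).  THIS FILE puts that ledger UNDER the (α) assembly: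
the window-explicit L-witness at `ellVolS82` (a NEW statement: `hIv`'s threshold differs from p290621 §2's), and a second
proof of the window-blind terminal theorem of record (leaf-02 g32's located point P-ne7bleaf02-g32-1: the `_fsc` statements
never name a window — `ForSmallCouplings` absorbs any positive threshold — so the census sentences are about the window
lemmas, not about the terminal statement).

WHAT.  §0 **`plug_of_shrunk82`** (the M5-2e instance of part 1 §3's plug, on the pass-V objects).  §1 **`HistReadDataLW.toLP82
(Dd) (hIr) (hIv) : HistReadDataLP …`** GIVEN the rounding window `InInterval e^{−ℓ⋆∕2} K` and the volume window `InInterval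
e^{−ℓᵥ82∕2} K` (`ellVolS82 C d κ₂ κᵥ cΛ θᵥ (1+β₀) (jvol82 d (1+β₀))`) for every cutoff.  §2 the L-witness
**`nonempty_countRoadWitnessT3bWTVSL_of_histReadingLW82`** (part 4 §1 ∘ `toLP82`; statement = p290621 §2's with the ONE hunk
`ellVol … (jvol …) ↦ ellVolS82 … (jvol82 …)` in `hIv`).  §3 `example : type_of% (continuumYM4Torus_of_histReadingLW_fsc …) :=` the LP road
through `forSmallCouplings_mono_inInterval₂` at the volume threshold `e^{−ℓᵥ82∕2}` — THE terminal theorem of record proved a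
second time, through M5-2e (file 2: the same for `…LWD_fsc`, `…LWK_fsc`).

BY-NAME EFFECT (`WALL-NE7b-P1.md` §2, G-M5-2): the terminal theorem of record is UNCHANGED BY NAME AND BY TYPE (it was
always window-blind); it now has a proof through M5-2e's ledger, and the window lemma the census sentence describes is §2's
at `ellVolS82`; classes unchanged («volume calibrations» ∕ (WS1⁸²) ∕
`RoundingRoomF` K modulo PREFIX + C-side; `HistRead`, M1's `Holds`, `hF`, `hΛ`, (ρ0)–(ρ3), (γ) R-class as booked).
HONEST SCOPE.  CONDITIONAL on everything the records display; ρ UNVALUED; nothing of Bałaban's asserted, instantiated or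
discharged; NE7b NOT proved; spine 0∕9.  HONEST DEPENDENCY (cell): continuum YM on T⁴ ⇐ BetaPertH ∧ nine spine estimates
(0/9 proved); BetaPertH ⇐ (D1) ∧ (D4) ∧ CAP+tail; G-an2-4 gates asym, D1 and NE2/3/4.  This file changes none of it.
-/
open Finset MeasureTheory
open Literature.MathematicalPhysics.QuantumFieldTheory.Balaban1983to89
open T4PersistenceDictionary T4PersistentHistoryCount T4BankedInduction T4PrintedShapeBanking
open T4WeightBudget T4GlobalDenominator T4LiveClassFibration T4LiveStructureGas T4LiveGasToTerms T4RecordPriceSeam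
open T4PartnerMultiplicity T4IndicatorShell T4MatchingAssembly T4MatchingClosure T4MatchingClosureSocket T4Continuum
open T4StabilitySocket T4BranchingRecordsGas T4TaggedShapeBanking T4CanonicalMenus T4RenewalChains
open Summit.QuantumFields.BalabanUV.T4Continuum.PlacementBatch Summit.QuantumFields.BalabanUV.T4Continuum.PlacementSkeleton
open Summit.QuantumFields.BalabanUV.T4Continuum.CountThresholdUniform Summit.QuantumFields.BalabanUV.T4Continuum.CountThresholdExit
open Summit.QuantumFields.BalabanUV.T4Continuum.CountSeamJunction Summit.QuantumFields.BalabanUV.T4Continuum.LateMergers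
open Summit.QuantumFields.BalabanUV.T4Continuum.HistoryFlow Summit.QuantumFields.BalabanUV.T4Continuum.HistoryRegeneration
open Summit.QuantumFields.BalabanUV.T4Continuum.HistoryTables Summit.QuantumFields.BalabanUV.T4Continuum.HistoryAssemblyTrees
open Summit.QuantumFields.BalabanUV.T4Continuum.HistoryAssemblyTerms Summit.QuantumFields.BalabanUV.T4Continuum.HistoryAssemblyPedigree
open Summit.QuantumFields.BalabanUV.T4Continuum.HistoryConstants Summit.QuantumFields.BalabanUV.T4Continuum.HistoryGen
open Literature.MathematicalPhysics.QuantumFieldTheory.Balaban1983to89.B13ScaleTransfer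
open Summit.QuantumFields.BalabanUV.T4Continuum.ZoneSkeleton Summit.QuantumFields.BalabanUV.T4Continuum.HistorySocketTH
open Summit.QuantumFields.BalabanUV.T4Continuum.HistoryCaps Summit.QuantumFields.BalabanUV.T4Continuum.HistoryAssemblyPrice
open Summit.QuantumFields.BalabanUV.T4Continuum.HistoryBankingLE Summit.QuantumFields.BalabanUV.T4Continuum.HistoryExitLE
open Summit.QuantumFields.BalabanUV.T4Continuum.HistoryAssemblyTreesLE Summit.QuantumFields.BalabanUV.T4Continuum.HistoryAssemblyTermsLE
open Summit.QuantumFields.BalabanUV.T4Continuum.HistoryRealise Summit.QuantumFields.BalabanUV.T4Continuum.HistoryAssemblyRealiseLE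
open Summit.QuantumFields.BalabanUV.T4Continuum.HistoryAssemblyMult Summit.QuantumFields.BalabanUV.T4Continuum.HistoryAssemblyMultKey
open Summit.QuantumFields.BalabanUV.T4Continuum.HistoryAssemblyRealiseRun Summit.QuantumFields.BalabanUV.T4Continuum.HistoryAssemblyRealiseMult
open Summit.QuantumFields.BalabanUV.T4Continuum.HistoryZones Summit.QuantumFields.BalabanUV.T4Continuum.HistoryRealiseCells
open Summit.QuantumFields.BalabanUV.T4Continuum.HistoryRealiseCellsRun Summit.QuantumFields.BalabanUV.T4Continuum.HistoryAssemblyRealiseRunMult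
open Summit.QuantumFields.BalabanUV.T4Continuum.HistoryRealiseCellsRunMult Summit.QuantumFields.BalabanUV.T4Continuum.HistoryAssemblyMultInstance
open Summit.QuantumFields.BalabanUV.T4Continuum.HistoryJoinsPlacedMember Summit.QuantumFields.BalabanUV.T4Continuum.PlacementSkeleton
open Summit.QuantumFields.BalabanUV.T4Continuum.HistoryJoinsPlacedMult Summit.QuantumFields.BalabanUV.T4Continuum.HistoryRealiseDistinct
open Summit.QuantumFields.BalabanUV.T4Continuum.HistoryRegionTemplates Summit.QuantumFields.BalabanUV.T4Continuum.HistoryCaps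
open Summit.QuantumFields.BalabanUV.T4Continuum.HistoryZoneEvolve (cth)
open Literature.MathematicalPhysics.QuantumFieldTheory.Balaban1983to89.B16SProfile (DropCtl)
open Summit.QuantumFields.BalabanUV.T4Continuum.HistoryRealiseCellsRunMultEnd Summit.QuantumFields.BalabanUV.T4Continuum.HistoryRealiseCellsRunMultEndD
open Summit.QuantumFields.BalabanUV.T4Continuum.HistoryRealiseCellsRunPinnedT3b Summit.QuantumFields.BalabanUV.T4Continuum.HistoryHybridRescale
open Summit.QuantumFields.BalabanUV.T4Continuum.HistoryRealiseCellsRunApex (exists_const_schemeZ)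
open Summit.QuantumFields.BalabanUV.T4Continuum.HistoryRealisePrint Summit.QuantumFields.BalabanUV.T4Continuum.HistoryRealiseWeak
open Summit.QuantumFields.BalabanUV.T4Continuum.HistoryRealisePrintReading Summit.QuantumFields.BalabanUV.T4Continuum.HistoryRealiseWeakReading
open Summit.QuantumFields.BalabanUV.T4Continuum.HistoryRealisePrintCells Summit.QuantumFields.BalabanUV.T4Continuum.HistoryRealiseWeakCells
open Summit.QuantumFields.BalabanUV.T4Continuum.HistoryRealiseCellsRunApexT3b Summit.QuantumFields.BalabanUV.T4Continuum.HistoryRealiseCellsRunApexT3bW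

open Summit.QuantumFields.BalabanUV.T4Continuum.HistoryRealiseCellsRunApexT3bWT Summit.QuantumFields.BalabanUV.T4Continuum.HistoryRealiseCellsRunPinnedT3bWT
open Summit.QuantumFields.BalabanUV.T4Continuum.HistoryRealiseCellsRunHeadlineT3bWT
open Summit.QuantumFields.BalabanUV.T4Continuum.HistoryRealiseCellsRunApexT3bWTV Summit.QuantumFields.BalabanUV.T4Continuum.HistoryBankingVolumePlug
open Summit.QuantumFields.BalabanUV.T4Continuum.HistoryRealiseCellsRunApexT3bWTVS
open Summit.QuantumFields.BalabanUV.T4Continuum.HistoryGenealogyRealise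
open Summit.QuantumFields.BalabanUV.T4Continuum.HistoryGenealogyInstantiate
open Summit.QuantumFields.BalabanUV.T4Continuum.B16HistoryIndexedRepr
open Summit.QuantumFields.BalabanUV.T4Continuum.B16HistoryIndexedTrunc
open Summit.QuantumFields.BalabanUV.T4Continuum.HistoryBankingDiscountCharge
open Summit.QuantumFields.BalabanUV.T4Continuum.HistoryBankingCreditRead
open Summit.QuantumFields.BalabanUV.T4Continuum.HistoryBankingFibreRoom
open Summit.QuantumFields.BalabanUV.T4Continuum.HistoryPriceKeys
open Summit.QuantumFields.BalabanUV.T4Continuum.HistoryRealiseCellsRunSupplyWTVS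
open Summit.QuantumFields.BalabanUV.T4Continuum.HistoryRealiseCellsRunSupplyKeysWTVS

open Summit.QuantumFields.BalabanUV.T4Continuum.HistoryRealiseCellsRunAssemblyWTVSData
open Summit.QuantumFields.BalabanUV.T4Continuum.HistoryRealiseCellsRunAssemblyWTVSDataL
open Summit.QuantumFields.BalabanUV.T4Continuum.HistoryRealiseCellsRunAssemblyWTVSDataLW
open Summit.QuantumFields.BalabanUV.T4Continuum.HistoryRealiseCellsRunAssemblyWTVSL
open Summit.QuantumFields.BalabanUV.T4Continuum.HistoryRealiseCellsRunApexT3bWTVSL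
open Summit.QuantumFields.BalabanUV.T4Continuum.HistoryBankingSharpShares (sBsharp)
open Summit.QuantumFields.BalabanUV.T4Continuum.HistoryBankingRoundingSupply (ellStar)
open Summit.QuantumFields.BalabanUV.T4Continuum.HistoryBankingRoundingUnrounded (sRunr ApFlat)
open Summit.QuantumFields.BalabanUV.T4Continuum.HistoryBankingRoundingTuned
open Summit.QuantumFields.BalabanUV.T4Continuum.HistoryBankingVolumeWindow
open Summit.QuantumFields.BalabanUV.T4Continuum.HistoryBankingVolumeSupply

open Summit.QuantumFields.BalabanUV.T4Continuum.HistoryBankingForestVolume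
open Summit.QuantumFields.BalabanUV.T4Continuum.HistoryBankingForestPlug
open Summit.QuantumFields.BalabanUV.T4Continuum.HistoryBankingAnchors82
open Summit.QuantumFields.BalabanUV.T4Continuum.HistoryBankingShrunkLedger82
open Summit.QuantumFields.BalabanUV.T4Continuum.HistoryBankingShrunkWitness82
open Summit.QuantumFields.BalabanUV.T4Continuum.HistoryBankingVolumeWindowCollar
open Summit.QuantumFields.BalabanUV.T4Continuum.HistoryBankingVolumeWindowShrunk82
open Summit.QuantumFields.BalabanUV.T4Continuum.B16HistoryWeightPlugW
open Summit.QuantumFields.BalabanUV.T4Continuum.HistoryRealiseCellsRunSupplyWTVSW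
open Summit.QuantumFields.BalabanUV.T4Continuum.HistoryRealiseCellsRunAssemblyWTVSDataLW
open Summit.QuantumFields.BalabanUV.T4Continuum.HistoryRealiseCellsRunAssemblyWTVSDataLP
open Summit.QuantumFields.BalabanUV.T4Continuum.HistoryRealiseCellsRunAssemblyWTVSLW
open Summit.QuantumFields.BalabanUV.T4Continuum.HistoryRealiseCellsRunAssemblyWTVSLP

namespace Summit.QuantumFields.BalabanUV.T4Continuum.HistoryRealiseCellsRunAssemblyWTVSLWP82

noncomputable section

set_option synthInstance.maxSize 1024

/-! ## §0 The M5-2e instance of the plug on the pass-V objects -/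

section PassV

variable {d : ℕ} {I : RunInputM d} {C : T4PrintedShapeBanking.Consts}

/-- **THE M5-2e INSTANCE** (`w = cvol82 d j Γ`): the per-level-dead-box displays (cumulative growth `Γ`, lag `j` with
`feed82 d·Γ ≤ 2^j∕2`, the floor `u_t·6·collar82 d ≤ floorK`, `E₂`∕`E₃` calibrations) ⇒ the plug — (E5)
`HistoryBankingShrunkWitness82.exp_volume_le_genT_shrunk82` on the pass-V objects through `HistoryBankingForestPlug` §1's three
dischargers (part 1 §3's pattern). [folklore] -/
theorem plug_of_shrunk82 (hN : I.NewOK) (hRm : ∀ t k, I.Rm t k ≤ I.R t) (hRmS : ∀ t k, I.Rm t (k + 1) ≤ I.R (t + 1))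
    (hRm2 : ∀ t, 2 ≤ I.Rm t 1) (hD : I.NewDisjoint) (hL : 0 < I.L) (hL4 : 4 ≤ I.L) (hdrop : ∀ m, DropCtl I.s m)
    (hR : ∀ t, 1 ≤ I.R t) (hn₁ : 13 ≤ C.n₁) (hE₂ : 0 ≤ C.E₂) (hE₃ : 0 ≤ C.E₃) {K : ℕ} {Λ : ℕ → ℝ} (hΛ : ∀ j, 1 ≤ Λ j)
    {Γ : ℝ} (hΓ0 : 0 ≤ Γ) (hΓ : ∀ t n, t ≤ n → Real.log (Λ n) ≤ Γ * Real.log (Λ t)) {j : ℕ} (hj1 : 1 ≤ j)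
    (hsmall : feed82 d * Γ ≤ 2 ^ j / 2)
    (huS : ∀ t, t ≤ K → Real.log (Λ t) * (6 * collar82 d) ≤ floorK C K I.R t)
    (huE₂ : ∀ n, n ≤ K → Real.log (Λ n) * (15 * 126 ^ d) ≤ C.E₂ * (I.R n : ℝ) ^ C.q')
    (huE₃ : ∀ n, n ≤ K → Real.log (Λ n) * (24 * 126 ^ d) ≤ C.E₃ * (I.R n : ℝ) ^ C.q') :
    ∀ c ∈ I.histV.comp K,
      Real.exp (treeVol I.L I.s (fun v => (v : ℝ)) I.pedMV (fun j => Real.log (Λ j)) K (K, c)) ≤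
        Real.exp (lifeCost (dictWT Prod.fst I.R C.n₁) (costT Prod.fst C K I.R) (I.pedMV.genT (K, c))) *
          Real.exp (birthWT Prod.fst (fun n => cvol82 d j Γ * Real.log (Λ n)) (I.pedMV.genT (K, c))) :=
  fun c hc => exp_volume_le_genT_shrunk82 hL4 hdrop hR hn₁ hE₂ hE₃ I.pedMV id RunInputM.renew_step_pedMV (K, c)
    (RunInputM.realisesW_pedMV hN hRm hRmS hRm2 hD hL hc) (wf_genT_pedMV hN hRm hRmS hRm2 hD hL hL4 hdrop hR hn₁ hc)
    (lastStep_toPGen_pedMV_le hN hRm hRmS hRm2 hD hL hc) (lt_reach_genT_pedMV hN hRm hRmS hRm2 hD hL hL4 hdrop hR hn₁ hc)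
    (fun n => Real.log_nonneg (hΛ n)) hΓ0 hΓ hj1 hsmall huS huE₂ huE₃

end PassV

/-! ## §1 The embedding at M5-2e's weight and window -/

section Embed

variable {F : T4Family} {G : Type*} [GaugeGroup G] [MeasurableSpace G] [HaarData G] [RegularGaugeGroup G]
  {D : FiniteEpsData F G} {C : T4PrintedShapeBanking.Consts} {O : PrintedO1s} {θv : ℝ} {rr d n : ℕ} {hn : 0 < n}
  {g₀ : ℕ → ℝ} {os : List (ULoop F)} {cΛ Lr Φ β₀ : ℝ} {p₁ η η' κ κ₂ κᵥ : ℕ} {DomK : ℕ → Type}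
  {I : (K : ℕ) → HIndex (DomK K)} [DecidableEq (HIndex.Idx I)] {DomK' : ℕ → Type} {I' : (K : ℕ) → HIndex (DomK' K)}
  {Xs : ℕ → Type} [∀ K, MeasurableSpace (Xs K)] {μ : (K : ℕ) → Measure (Xs K)} [∀ K, IsFiniteMeasure (μ K)]
  {𝒢 : (K : ℕ) → GoodClass (Xs K)} {Y : ℕ → Type} [∀ K, MeasurableSpace (Y K)] {νB : (K : ℕ) → Measure (Y K)}
  [∀ K, IsFiniteMeasure (νB K)] {𝒢' : (K : ℕ) → GoodClass (Y K)}

omit [RegularGaugeGroup G] in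
/-- **THE PLUG OF A PREFIX RECORD AT M5-2e's LEDGER, per term**: under the volume window `InInterval e^{−ℓᵥ82∕2} K`, leaf-06's
`volumeDisplaysS82_of_log_eq_of_inInterval` at the record's `hΛ K` supplies (E4)'s eight binders on `u = log ∘ Λ K`, and §0
turns them into the plug at `w = cvol82 d (jvol82 d (1+β₀)) (1+β₀)` on the run read off each term. [folklore] -/
theorem plug82_of_histReadingLW (Dd : HistReadDataLW D C O θv rr d n hn g₀ os cΛ Lr Φ β₀ p₁ η η' κ κ₂ κᵥ I I' Xs μ 𝒢 Y νB 𝒢')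
    (hIv : ∀ K, (D.C ⟨K, F.m, g₀ K⟩).flow.InInterval
      (Real.exp (-(ellVolS82 C d κ₂ κᵥ cΛ θv (1 + β₀) (jvol82 d (1 + β₀)) / 2))) K) :
    ∀ K, Dd.K₀ ≤ K → ∀ τ ∈ HIndex.termSet I K, ∀ x ∈ (Dd.ℛ.inputOf.run K τ).histV.comp K,
      Real.exp (treeVol Dd.ℛ.L (Dd.ℛ.s K) (fun v => (v : ℝ)) (Dd.ℛ.inputOf.run K τ).pedMV
          (fun j => Real.log (Dd.Φf.Λ K j)) K (K, x)) ≤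
        Real.exp (lifeCost (dictWT Prod.fst (Dd.ℛ.R K) C.n₁) (costT Prod.fst C K (Dd.ℛ.R K))
            ((Dd.ℛ.inputOf.run K τ).pedMV.genT (K, x))) *
          Real.exp (birthWT Prod.fst (fun m => cvol82 d (jvol82 d (1 + β₀)) (1 + β₀) * Real.log (Dd.Φf.Λ K m))
            ((Dd.ℛ.inputOf.run K τ).pedMV.genT (K, x))) := by
  intro K hK τ hτ
  obtain ⟨⟨a, h, l, c⟩, -, hpe⟩ := Finset.mem_map.mp hτ
  have hτe : τ = ⟨K, a, (h, l, c)⟩ := hpe.symm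
  subst hτe
  have hL0 : 0 < Dd.ℛ.L := by rw [Dd.hL]; exact lt_of_lt_of_le (by norm_num) (two_le_L F)
  have hL4 : 4 ≤ Dd.ℛ.L := by rw [Dd.hL]; exact Dd.hL4
  have hdrop : ∀ m, DropCtl (Dd.ℛ.s K) m := by rw [Dd.hs]; exact Dd.hdrop K hK
  -- leaf-06's eight binders at the pinned cost, this cutoff (IR-51-1 part 2)
  have vd : VolumeDisplaysS82 C d K (Dd.ℛ.R K) (fun t => Real.log (Dd.Φf.Λ K t)) (1 + β₀) (jvol82 d (1 + β₀)) :=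
    volumeDisplaysS82_of_log_eq_of_inInterval (D.C ⟨K, F.m, g₀ K⟩).flow (hIv K) (Dd.hΛ K) Dd.hexpF Dd.hexpV Dd.hκ₂ Dd.hκᵥ
      Dd.hcΛ Dd.hE₂ Dd.hE₃pos Dd.hθv Dd.hA₀.ne' Dd.hβ₀ Dd.hp27 (Dd.h27 K hK) (fun t ht => Dd.isRj K t ht) le_rfl
  simp only [HistReading.run_inputOf]
  exact plug_of_shrunk82 (I := Dd.ℛ.runOf K a (h, l, c)) (C := C) (Dd.hN K hK _ hτ) (Dd.hRm K hK _ hτ) (Dd.hRmS K hK _ hτ)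
    (Dd.hRm2 K hK _ hτ) (Dd.hD K hK _ hτ) hL0 hL4 hdrop (Dd.one_le_R K hK) Dd.hn₁ Dd.hE₂.le Dd.hE₃pos.le
    (fun j => Dd.Φf.one_le_Λ K j) vd.hΓ0 vd.hΓ vd.hj1 vd.hsmall vd.huS vd.huE₂ vd.huE₃

omit [RegularGaugeGroup G] in
/-- **THE D-50-2 EMBEDDING**: a prefix record `HistReadDataLW` together with the rounding window `InInterval e^{−ℓ⋆∕2} K` and
the M5-2e volume window `InInterval e^{−ℓᵥ82∕2} K` for every cutoff IS a plug record `HistReadDataLP` at the weight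
`cvol82 d (jvol82 d (1+β₀)) (1+β₀)` — `hRR`∕`hRR′` by the owner's `roundingRoomF_unrounded_of_inInterval` (as `toL`), `hwV` by
`two_pow_le_cvol82`, `hplug := plug82_of_histReadingLW`, `huV` by leaf-06's `huθS82_births_of_log_eq_of_inInterval` on the
members' performed births, everything else copied (`sR`∕`sR′ := sRunr …`, `hE₃ := hE₃pos.le`). [folklore] -/
def _root_.Summit.QuantumFields.BalabanUV.T4Continuum.HistoryRealiseCellsRunAssemblyWTVSDataLW.HistReadDataLW.toLP82
    (Dd : HistReadDataLW D C O θv rr d n hn g₀ os cΛ Lr Φ β₀ p₁ η η' κ κ₂ κᵥ I I' Xs μ 𝒢 Y νB 𝒢')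
    (hIr : ∀ K, (D.C ⟨K, F.m, g₀ K⟩).flow.InInterval
      (Real.exp (-(ellStar C O F.L (O.d + 3) η η' κ (ApFlat O.γ₀ O.A₁ O.M Lr O.d) Φ / 2))) K)
    (hIv : ∀ K, (D.C ⟨K, F.m, g₀ K⟩).flow.InInterval
      (Real.exp (-(ellVolS82 C d κ₂ κᵥ cΛ θv (1 + β₀) (jvol82 d (1 + β₀)) / 2))) K) :
    HistReadDataLP D C O θv rr d n hn g₀ os I I' Xs μ 𝒢 Y νB 𝒢' :=
  have hL1 : 1 ≤ F.L := le_trans (by norm_num) (two_le_L F)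
  have hβ₀' : (0 : ℝ) ≤ 1 + β₀ := by have := Dd.hβ₀; linarith
  { l₀ := Dd.l₀, vol := Dd.vol, l₀_pos := Dd.l₀_pos, vol_pos := Dd.vol_pos, K₀ := Dd.K₀, RA := Dd.RA, ρA := Dd.ρA,
    holdsA := Dd.holdsA, intA := Dd.intA, H2A := Dd.H2A, ℛ := Dd.ℛ, hL := Dd.hL, hs := Dd.hs, Φf := Dd.Φf,
    hR := Dd.hR, isRj := Dd.isRj, one_le_R := Dd.one_le_R, hL4 := Dd.hL4, hprof := Dd.hprof, hdrop := Dd.hdrop,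
    hN := Dd.hN, hRm := Dd.hRm, hRmS := Dd.hRmS, hRm2 := Dd.hRm2, hD := Dd.hD, hreg := Dd.hreg, hn₁ := Dd.hn₁,
    hE₂ := Dd.hE₂, hE₃ := Dd.hE₃pos.le,
    -- D-50-2: M5-2e's weight, its floor, THE PLUG and the slack at that weight
    wV := fun _ => cvol82 d (jvol82 d (1 + β₀)) (1 + β₀), hwV := fun _ _ => two_pow_le_cvol82 d _ hβ₀',
    hplug := plug82_of_histReadingLW Dd hIv,
    sB := Dd.sB,
    sR := fun K => sRunr O.γ₀ O.A₁ O.M Lr O.β₀ O.d p₁ (Dd.ℛ.R K) (D.C ⟨K, F.m, g₀ K⟩).flow.g,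
    φB := Dd.φB, φR := Dd.φR, β' := Dd.β', β₀ := β₀, hF := Dd.hF,
    hRR := fun K hK =>
      roundingRoomF_unrounded_of_inInterval (D.C ⟨K, F.m, g₀ K⟩).flow (hIr K) Dd.hexpR Dd.hexpR' Dd.hexpB Dd.hη Dd.hη'
        Dd.hκ Dd.hp₀ Dd.hAp Dd.hγ₀ Dd.hA₁ Dd.hA₀ Dd.hM Dd.hLr Dd.hβd Dd.hΦ Dd.hE₂ Dd.hE₃pos.le hL1 Dd.hm (Dd.h29 K hK)
        (fun j hj => Dd.isRj K j hj) (Dd.one_le_R K hK) le_rfl (Dd.hφB K) (Dd.hφR K) (Dd.hsB K),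
    h29 := Dd.h29,
    huV := fun K _ τ _ q hq => by
      obtain ⟨c, hc, rfl⟩ := mem_memOf.1 hq
      obtain ⟨x, -, rfl⟩ := Finset.mem_image.1 hc
      exact huθS82_births_of_log_eq_of_inInterval (D.C ⟨K, F.m, g₀ K⟩).flow (hIv K) (Dd.hΛ K) Dd.hexpF Dd.hexpV Dd.hκ₂
        Dd.hκᵥ Dd.hcΛ Dd.hE₂ Dd.hE₃pos Dd.hθv Dd.hA₀.ne' Dd.hβ₀ le_rfl Prod.fst _ (births_le_of_step_le _ _ le_rfl),
    W := Dd.W, one_le_W := Dd.one_le_W, Wi := Dd.Wi, BAi := Dd.BAi, mi := Dd.mi, hWi := Dd.hWi, hBA := Dd.hBA,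
    hmi := Dd.hmi, hρ := Dd.hρ, c₀ := Dd.c₀, n₁ := Dd.n₁, c₀_pos := Dd.c₀_pos, floor := Dd.floor,
    floor' := Dd.floor', sites := Dd.sites, sites' := Dd.sites', RB := Dd.RB, ρB := Dd.ρB, holdsB := Dd.holdsB,
    intB := Dd.intB, H2B := Dd.H2B, trunc := Dd.trunc, htr := Dd.htr, dB := Dd.dB, mup := Dd.mup, sB' := Dd.sB',
    φB' := Dd.φB',
    sR' := fun K => sRunr O.γ₀ O.A₁ O.M Lr O.β₀ O.d p₁ (Dd.ℛ.R K) (D.C ⟨K, F.m, g₀ K⟩).flow.g,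
    φR' := Dd.φR',
    hRR' := fun K hK =>
      roundingRoomF_unrounded_of_inInterval (D.C ⟨K, F.m, g₀ K⟩).flow (hIr K) Dd.hexpR Dd.hexpR' Dd.hexpB Dd.hη Dd.hη'
        Dd.hκ Dd.hp₀ Dd.hAp Dd.hγ₀ Dd.hA₁ Dd.hA₀ Dd.hM Dd.hLr Dd.hβd Dd.hΦ Dd.hE₂ Dd.hE₃pos.le hL1 Dd.hm (Dd.h29 K hK)
        (fun j hj => Dd.isRj K j hj) (Dd.one_le_R K hK) le_rfl (Dd.hφB' K) (Dd.hφR' K) (Dd.hsB' K),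
    upB := Dd.upB, deadB_nonneg := Dd.deadB_nonneg, resumB := Dd.resumB, mup_bd := Dd.mup_bd, shA := Dd.shA,
    shB := Dd.shB, Wsh := Dd.Wsh, shell := Dd.shell, Cc := Dd.Cc, Rr := Dd.Rr, CcRec := Dd.CcRec, RrRec := Dd.RrRec,
    ν := Dd.ν, u := Dd.u, s₂ := Dd.s₂, q₀ := Dd.q₀, r := Dd.r, s := Dd.s, budget := Dd.budget, sum_r := Dd.sum_r,
    sum_u := Dd.sum_u, sum_s := Dd.sum_s, sum_s₂ := Dd.sum_s₂ }

omit [RegularGaugeGroup G] in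
/-- the embedding keeps the reading, the threshold, the factor data, the source radius and the truncation and FIXES the
weight to M5-2e's `cvol82 d (jvol82 d (1+β₀)) (1+β₀)` [folklore] -/
theorem _root_.Summit.QuantumFields.BalabanUV.T4Continuum.HistoryRealiseCellsRunAssemblyWTVSDataLW.HistReadDataLW.toLP82_data
    (Dd : HistReadDataLW D C O θv rr d n hn g₀ os cΛ Lr Φ β₀ p₁ η η' κ κ₂ κᵥ I I' Xs μ 𝒢 Y νB 𝒢')
    (hIr : ∀ K, (D.C ⟨K, F.m, g₀ K⟩).flow.InInterval
      (Real.exp (-(ellStar C O F.L (O.d + 3) η η' κ (ApFlat O.γ₀ O.A₁ O.M Lr O.d) Φ / 2))) K)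
    (hIv : ∀ K, (D.C ⟨K, F.m, g₀ K⟩).flow.InInterval
      (Real.exp (-(ellVolS82 C d κ₂ κᵥ cΛ θv (1 + β₀) (jvol82 d (1 + β₀)) / 2))) K) :
    (Dd.toLP82 hIr hIv).ℛ = Dd.ℛ ∧ (Dd.toLP82 hIr hIv).K₀ = Dd.K₀ ∧ (Dd.toLP82 hIr hIv).Φf = Dd.Φf ∧
      (Dd.toLP82 hIr hIv).l₀ = Dd.l₀ ∧ (Dd.toLP82 hIr hIv).trunc = Dd.trunc ∧
      ((Dd.toLP82 hIr hIv).wV = fun _ => cvol82 d (jvol82 d (1 + β₀)) (1 + β₀)) :=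
  ⟨rfl, rfl, rfl, rfl, rfl, rfl⟩

end Embed

/-! ## §2 The L-witness on M5-2e's ledger from a prefix record -/

section Assembly

variable {F : T4Family} {G : Type*} [GaugeGroup G] [MeasurableSpace G] [HaarData G] [RegularGaugeGroup G]
  {D : FiniteEpsData F G} {C : T4PrintedShapeBanking.Consts} {O : PrintedO1s} {θv : ℝ} {rr d n : ℕ} {hn : 0 < n}
  {g₀ : ℕ → ℝ} {os : List (ULoop F)} {cΛ Lr Φ β₀ : ℝ} {p₁ η η' κ κ₂ κᵥ : ℕ} {DomK : ℕ → Type}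
  {I : (K : ℕ) → HIndex (DomK K)} [DecidableEq (HIndex.Idx I)] {DomK' : ℕ → Type} {I' : (K : ℕ) → HIndex (DomK' K)}
  {Xs : ℕ → Type} [∀ K, MeasurableSpace (Xs K)] {μ : (K : ℕ) → Measure (Xs K)} [∀ K, IsFiniteMeasure (μ K)]
  {𝒢 : (K : ℕ) → GoodClass (Xs K)} {Y : ℕ → Type} [∀ K, MeasurableSpace (Y K)] {νB : (K : ℕ) → Measure (Y K)}
  [∀ K, IsFiniteMeasure (νB K)] {𝒢' : (K : ℕ) → GoodClass (Y K)}

omit [RegularGaugeGroup G] in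
/-- **THE L-WITNESS FROM A PREFIX RECORD ON M5-2e's LEDGER** (part 4 §1 ∘ `toLP82`). [folklore] -/
theorem nonempty_countRoadWitnessT3bWTVSL_of_histReadingLW82
    (Dd : HistReadDataLW D C O θv rr d n hn g₀ os cΛ Lr Φ β₀ p₁ η η' κ κ₂ κᵥ I I' Xs μ 𝒢 Y νB 𝒢')
    (hIr : ∀ K, (D.C ⟨K, F.m, g₀ K⟩).flow.InInterval
      (Real.exp (-(ellStar C O F.L (O.d + 3) η η' κ (ApFlat O.γ₀ O.A₁ O.M Lr O.d) Φ / 2))) K)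
    (hIv : ∀ K, (D.C ⟨K, F.m, g₀ K⟩).flow.InInterval
      (Real.exp (-(ellVolS82 C d κ₂ κᵥ cΛ θv (1 + β₀) (jvol82 d (1 + β₀)) / 2))) K) :
    Nonempty (CountRoadWitnessT3bWTVSL D C O θv rr d n hn g₀ os (HIndex.Idx I) (ℕ × Lab d) (Lab d)) :=
  nonempty_countRoadWitnessT3bWTVSL_of_histReadingLP (Dd.toLP82 hIr hIv)

end Assembly

/-! ## §3 The terminal theorem of record, proved a second time through the per-level dead-box ledger -/

section SU

variable {F : T4Family} {N : ℕ} [NeZero N] {ℰ : LoopAverage (Matrix.specialUnitaryGroup (Fin N) ℂ)}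

/-- **THE TERMINAL THEOREM OF RECORD HAS A SECOND PROOF THROUGH M5-2e's LEDGER** (conservativity certificate; an
`example`, so that no landed statement is re-declared).  Located by leaf-02 g32 (P-ne7bleaf02-g32-1) and ADOPTED: the
statement of `HistoryRealiseCellsRunAssemblyWTVSLW.continuumYM4Torus_of_histReadingLW_fsc` (p290621) is WINDOW-BLIND by construction
(D-48-1: the two coupling windows are manufactured INSIDE the proof by `forSmallCouplings_mono_inInterval₂` for ANY positive
thresholds, absorbed by `ForSmallCouplings`), so re-running it on the per-level dead-box ledger cannot change its TYPE; what is
new in the kernel is §2's window-EXPLICIT L-witness at `ellVolS82` and the proof route (part 4's LP road ∘ §1).  Here the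
elaborator certifies that the LP road ∘ `toLP82` at the volume window `e^{−ℓᵥ82∕2}` proves THE terminal statement of record,
read off by `type_of%`.  The census sentences (G37∕G39∕VOLUME-4) are sentences about the window lemmas ∕ the size of the
implicit small coupling, never about this statement. [folklore] -/
example (D : FiniteEpsData F (Matrix.specialUnitaryGroup (Fin N) ℂ))
    (hBA : D.IsBlockAveraged ℰ) (hE : ℰ.MeasurableE)
    (hB : B16.EndStatementBPrinted D.C) (hβ : BetaPertHyp D.βfun) (hsign : B16.SignConventions D.C)
    {C : T4PrintedShapeBanking.Consts} {O : PrintedO1s}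
    {rr : ℕ} {β₀ : ℝ} (h : ThresholdOK C F.L rr β₀) (hμ : 0 < C.μ) (d n : ℕ)
    (hκ₁ : (d : ℝ) * Real.log F.L + 2 * Real.log 2 ≤ C.κ₁) (hE₀ : Real.log (2 + birthMass C) ≤ C.E₀)
    (hA₀ : 1 ≤ C.A₀) (hβ₀ : 0 < β₀) (hLβ : (F.L : ℝ) * β₀ ≤ 1) (hn₁ : 13 ≤ C.n₁) (hn : 0 < n)
    {θ θv : ℝ} (hθ : 0 < θ) (hslack : C.a + (θ + θv) ≤ O.γ₀ * O.A₁ ^ 2 / 2)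
    (hE₂ : 0 < C.E₂) (hE₃ : 0 ≤ C.E₃) {sS : ℕ} (hsS : 1 ≤ sS)
    (hsmall : (((2 * cth 32 1 sS + 1) ^ d : ℕ) : ℝ) * (5 : ℝ) ^ d * ((max 1 (2 * 32 + 2) : ℕ) : ℝ) ≤
      (F.L : ℝ) ^ (sS / 2) / 2)
    {θc : ℝ} (hθc0 : 0 ≤ θc) (hθc1 : θc < 1) (hθcs : 1 / 2 ≤ θc ^ sS)
    {cΛ Lr Φ b₀ : ℝ} {p₁ η η' κ κ₂ κᵥ : ℕ}
    (hRead : T4ContinuumYM4Torus.ForSmallCouplings D fun g₀ => ∀ os : List (ULoop F),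
        ∃ (DomK : ℕ → Type) (I : (K : ℕ) → HIndex (DomK K)) (_ : DecidableEq (HIndex.Idx I)) (DomK' : ℕ → Type)
          (I' : (K : ℕ) → HIndex (DomK' K)) (X : ℕ → Type) (_ : ∀ K, MeasurableSpace (X K))
          (μ : (K : ℕ) → Measure (X K)) (_ : ∀ K, IsFiniteMeasure (μ K)) (𝒢 : (K : ℕ) → GoodClass (X K))
          (Y : ℕ → Type) (_ : ∀ K, MeasurableSpace (Y K)) (νB : (K : ℕ) → Measure (Y K))
          (_ : ∀ K, IsFiniteMeasure (νB K)) (𝒢' : (K : ℕ) → GoodClass (Y K)),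
          Nonempty (HistReadDataLW D C O θv rr d n hn g₀ os cΛ Lr Φ b₀ p₁ η η' κ κ₂ κᵥ I I' X μ 𝒢 Y νB 𝒢')) :
    type_of% (continuumYM4Torus_of_histReadingLW_fsc D hBA hE hB hβ hsign h hμ d n hκ₁ hE₀ hA₀ hβ₀ hLβ hn₁ hn hθ hslack hE₂
      hE₃ hsS hsmall hθc0 hθc1 hθcs hRead) :=
  continuumYM4Torus_of_histReadingLP_fsc D hBA hE hB hβ hsign h hμ d n hκ₁ hE₀ hA₀ hβ₀ hLβ hn₁ hn hθ hslack hE₂ hE₃ hsS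
    hsmall hθc0 hθc1 hθcs
    (forSmallCouplings_mono_inInterval₂ D
      (Real.exp_pos (-(ellStar C O F.L (O.d + 3) η η' κ (ApFlat O.γ₀ O.A₁ O.M Lr O.d) Φ / 2)))
      (Real.exp_pos (-(ellVolS82 C d κ₂ κᵥ cΛ θv (1 + b₀) (jvol82 d (1 + b₀)) / 2)))
      (fun g₀ hIr hIv hg os => by
        obtain ⟨DomK, I, iI, DomK', I', X, mX, μ, hμf, 𝒢, Y, mY, νB, hνf, 𝒢', ⟨Dd⟩⟩ := hg os
        exact ⟨DomK, I, iI, DomK', I', X, mX, μ, hμf, 𝒢, Y, mY, νB, hνf, 𝒢', ⟨Dd.toLP82 hIr hIv⟩⟩)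
      hRead)

end SU

end

end Summit.QuantumFields.BalabanUV.T4Continuum.HistoryRealiseCellsRunAssemblyWTVSLWP82
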